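import Literature.Probability.Percolation.TriExplorationPolygon
import Literature.Probability.Percolation.TriLatticeCells
import Literature.Probability.RandomPlanarGeometry.ExteriorULC
import Literature.Probability.RandomPlanarGeometry.JordanDomainInterior
import HarnessLib

/-!
# The hexagonal exploration polygon and the boundary of a Jordan domain: frozen sites and the exterior

Topic: Probability / Percolation (boundary bookkeeping for the multiple-crossing estimate of the
site-percolation exploration path, Aizenman–Burchard, Duke Math. J. 99 (1999), App. A, in a
Jordan Dobrushin domain; the triangular replacement of Part II of `InterfaceTraversalBound.lean`).

Why a replacement is needed. The bond-`ℤ²` medial exploration of `MedialInterface.lean` travels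
through *inner* faces only, so its polygon lies in the open domain and misses the boundary curve
(`pertTrace_disjoint_frontier`), which is what the bond-side count of "tainted" side components
(`card_le_of_separated_frontier_points`) consumes. G02's hexagonal exploration path
(`LatticeInterface.lean`) only requires each *crossed* edge to be an edge of `Ω_δ`: the faces it
visits may have a third side leaving `closure Ω`, and the polygon through the face *centres* may
then leave the domain and cross the boundary curve inside such faces. The bookkeeping below never
uses `trace ⊆ Ω`; it rests instead on two facts:

* an edge of `𝕋` which is **not** an edge of `Ω_δ` is never crossed by the path, hence (by the
  lattice geometry of `TriExplorationPolygon.lean`) misses the polygon: walks in the graph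
  `offDomGraph` of such edges keep their mesh points in one component of the complement of the
  polygon (`triMeshPoint_mem_connectedComponentIn_of_reachable`);
* the exterior `E = (closure Ω)ᶜ` of the Jordan curve misses every edge of `Ω_δ` (their segments
  lie in `closure Ω`), so a continuous path in `E` only meets non-`Ω_δ` edges: following it from
  cell to cell transports the set `cutVerts` of endpoints of *cut* sides (sides leaving
  `closure Ω`) of the cells containing the current point along one `offDomGraph`-class
  (`reachable_of_path`; the cells of `TriLatticeCells.lean`, the Jordan-curve input
  `JordanDomain.interior_subset_of_frontier_subset_closure` to see that an exterior point lies in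
  a cell with a cut side, `cutVerts_nonempty`).

Consequences proved here: every site of the discrete boundary `∂Ω_δ` (in particular every site
of the discrete arcs, i.e. every *frozen* site) is joined in `offDomGraph`, within two steps, to a
cut vertex seen from an exterior point within `2δ` (`exists_exterior_repr`); and two such sites
whose exterior representatives are joined by an exterior path lie, with their mesh points, in the
same component of the complement of the polygon. With the uniform local connectedness of the
exterior (`JordanDomain.exterior_joinedIn_of_dist_lt`, Newman VI.14·1) this bounds the number of
side components containing frozen sites by a packing number, independently of the mesh
(`TriInterfaceTraversalBound.lean`).

## References

* M. Aizenman, A. Burchard, Duke Math. J. 99 (1999), Appendix A (the interior argument; the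
  boundary bookkeeping is not in print, cf. the docstring of `bondExploration_traversalBound`).
* M. H. A. Newman, *Elements of the topology of plane sets of points* (1939), Ch. VI §14.
* S. Smirnov, C. R. Acad. Sci. Paris 333 (2001), §2 (discretisation `Ω_δ`, arcs).
-/

noncomputable section

open Set Metric Complex
open _root_.Topology

namespace Literature.Probability.Percolation

open LatticeModels

/-! ### Edges of `𝕋` off the discrete domain, cut edges, cut vertices -/

section OffDomain

variable (Ω : Set ℂ) (δ : ℝ)

/-- The graph of **edges of `𝕋` that are not edges of `Ω_δ`**, with both endpoints (as mesh
points) in the window `W`. Such edges are never crossed by an exploration path. [folklore] -/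
def offDomGraph (W : Set ℂ) : SimpleGraph (Site 2) where
  Adj a b := triGraph.Adj a b ∧ ¬ (triDiscreteDomainGraph Ω δ).Adj a b ∧
    triMeshPoint δ a ∈ W ∧ triMeshPoint δ b ∈ W
  symm := ⟨fun _ _ h ↦ ⟨h.1.symm, fun h' ↦ h.2.1 h'.symm, h.2.2.2, h.2.2.1⟩⟩
  loopless := ⟨fun _ h ↦ h.1.ne rfl⟩

/-- A **cut edge**: an edge of `𝕋` whose closed segment at mesh `δ` leaves `closure Ω`.
[folklore] -/
def IsCutEdge (a b : Site 2) : Prop :=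
  triGraph.Adj a b ∧ ¬ segment ℝ (triMeshPoint δ a) (triMeshPoint δ b) ⊆ closure Ω

/-- The **cut vertices seen from `z`**: endpoints of cut sides of the closed cells of `δ𝕋`
containing `z`. [folklore] -/
def cutVerts (z : ℂ) : Set (Site 2) :=
  {v | ∃ (F : HexVertex) (j : Fin 3), (δ⁻¹ : ℂ) * z ∈ triCell F ∧
    IsCutEdge Ω δ (faceVertex F (j + 1)) (faceVertex F (j + 2)) ∧
    (v = faceVertex F (j + 1) ∨ v = faceVertex F (j + 2))}

variable {Ω δ}

/-- Cut edges are symmetric. [folklore] -/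
theorem IsCutEdge.symm {a b : Site 2} (h : IsCutEdge Ω δ a b) : IsCutEdge Ω δ b a :=
  ⟨h.1.symm, by rw [segment_symm]; exact h.2⟩

/-- A cut edge is not an edge of the discrete domain. [folklore] -/
theorem IsCutEdge.not_domAdj {a b : Site 2} (h : IsCutEdge Ω δ a b) :
    ¬ (triDiscreteDomainGraph Ω δ).Adj a b := fun h' ↦
  h.2 (triMeshGraph_adj_iff.1 (triDiscreteDomainGraph_adj_iff.1 h').1).2

/-- A cut edge inside the window is an edge of `offDomGraph`. [folklore] -/
theorem IsCutEdge.offDom_adj {W : Set ℂ} {a b : Site 2} (h : IsCutEdge Ω δ a b) (ha : triMeshPoint δ a ∈ W)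
    (hb : triMeshPoint δ b ∈ W) : (offDomGraph Ω δ W).Adj a b :=
  ⟨h.1, h.not_domAdj, ha, hb⟩

/-- An edge of `𝕋` whose segment contains a point outside `closure Ω` is cut. [folklore] -/
theorem isCutEdge_of_mem {a b : Site 2} (hab : triGraph.Adj a b) {z : ℂ}
    (hz : z ∈ segment ℝ (triMeshPoint δ a) (triMeshPoint δ b)) (hzE : z ∈ (closure Ω)ᶜ) : IsCutEdge Ω δ a b :=
  ⟨hab, fun h ↦ hzE (h hz)⟩

/-- Membership in `cutVerts`, unfolded. [folklore] -/
theorem mem_cutVerts_iff {z : ℂ} {v : Site 2} : v ∈ cutVerts Ω δ z ↔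
    ∃ (F : HexVertex) (j : Fin 3), (δ⁻¹ : ℂ) * z ∈ triCell F ∧
      IsCutEdge Ω δ (faceVertex F (j + 1)) (faceVertex F (j + 2)) ∧
      (v = faceVertex F (j + 1) ∨ v = faceVertex F (j + 2)) := Iff.rfl

end OffDomain

/-! ### The cells at mesh `δ` and the Jordan curve: an exterior point sees a cut side -/

section Cells

variable {δ : ℝ}

/-- The closed cell `F` at mesh `δ`: the points `z` with `δ⁻¹ z ∈ triCell F`. [folklore] -/
def meshCell (δ : ℝ) (F : HexVertex) : Set ℂ := {z | (δ⁻¹ : ℂ) * z ∈ triCell F}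

/-- The mesh cell is the preimage of the cell under the dilation by `δ⁻¹`. [folklore] -/
theorem meshCell_eq_preimage (hδ : δ ≠ 0) (F : HexVertex) :
    meshCell δ F = (Homeomorph.mulLeft₀ (δ⁻¹ : ℂ) (inv_ne_zero (Complex.ofReal_ne_zero.2 hδ))) ⁻¹' triCell F :=
  rfl

/-- The frontier of a mesh cell lies in the union of its sides at mesh `δ`. [folklore] -/
theorem frontier_meshCell_subset (hδ : δ ≠ 0) (F : HexVertex) :
    frontier (meshCell δ F) ⊆ ⋃ j, segment ℝ (triMeshPoint δ (faceVertex F (j + 1))) (triMeshPoint δ (faceVertex F (j + 2))) := by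
  rw [meshCell_eq_preimage hδ, ← Homeomorph.preimage_frontier]
  intro z hz
  obtain ⟨j, hj⟩ := mem_iUnion.1 (frontier_triCell_subset F hz)
  exact mem_iUnion.2 ⟨j, (mem_side_mesh_iff hδ).2 hj⟩

/-- A mesh cell lies within `2δ` of the mesh point of its cell (for `δ > 0`). [folklore] -/
theorem meshCell_subset_closedBall (hδ : 0 < δ) (F : HexVertex) :
    meshCell δ F ⊆ closedBall (triMeshPoint δ F.1) (2 * δ) := by
  intro z hz
  have h := norm_sub_triEmbed_le_of_mem_triCell hz
  rw [mem_closedBall, dist_eq_norm, triMeshPoint]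
  have : z - (δ : ℂ) * triEmbed F.1 = (δ : ℂ) * ((δ⁻¹ : ℂ) * z - triEmbed F.1) := by
    have hδ' : (δ : ℂ) ≠ 0 := Complex.ofReal_ne_zero.2 hδ.ne'
    field_simp
  rw [this, norm_mul, Complex.norm_real, Real.norm_eq_abs, abs_of_pos hδ]
  nlinarith

/-- The mesh cell is bounded. [folklore] -/
theorem isBounded_meshCell (hδ : 0 < δ) (F : HexVertex) : Bornology.IsBounded (meshCell δ F) :=
  isBounded_closedBall.subset (meshCell_subset_closedBall hδ F)

/-- **An exterior point of a Jordan domain lies in a cell with a cut side** (otherwise the three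
sides, hence the frontier of the cell, lie in `closure Ω`, and so does the whole cell by the
Jordan curve theorem, `JordanDomain.interior_subset_of_frontier_subset_closure`). Hence
`cutVerts` is nonempty at exterior points. [folklore] -/
theorem exists_isCutEdge_of_mem_triCell (Dj : RandomPlanarGeometry.JordanDomain) (hδ : 0 < δ) {z : ℂ}
    (hz : z ∈ (closure Dj.carrier)ᶜ) {F : HexVertex} (hF : (δ⁻¹ : ℂ) * z ∈ triCell F) :
    ∃ j : Fin 3, IsCutEdge Dj.carrier δ (faceVertex F (j + 1)) (faceVertex F (j + 2)) := by
  by_contra hne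
  push Not at hne
  -- no side of `F` is cut
  have hsides : ∀ j, segment ℝ (triMeshPoint δ (faceVertex F (j + 1))) (triMeshPoint δ (faceVertex F (j + 2))) ⊆
      closure Dj.carrier := by
    intro j
    by_contra h
    exact hne j ⟨triGraph_adj_faceVertex_succ F j, h⟩
  have hfr : frontier (meshCell δ F) ⊆ closure Dj.carrier := by
    intro y hy
    obtain ⟨j, hj⟩ := mem_iUnion.1 (frontier_meshCell_subset hδ.ne' F hy)
    exact hsides j hj
  have key := (Dj.interior_subset_of_frontier_subset_closure (isBounded_meshCell hδ F) hfr).2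
  exact hz (key (subset_closure (show z ∈ meshCell δ F from hF)))

/-- `cutVerts` is nonempty at exterior points. [folklore] -/
theorem cutVerts_nonempty (Dj : RandomPlanarGeometry.JordanDomain) (hδ : 0 < δ) {z : ℂ}
    (hz : z ∈ (closure Dj.carrier)ᶜ) : (cutVerts Dj.carrier δ z).Nonempty := by
  obtain ⟨F, hF⟩ := exists_mem_triCell ((δ⁻¹ : ℂ) * z)
  obtain ⟨j, hj⟩ := exists_isCutEdge_of_mem_triCell Dj hδ hz hF
  exact ⟨_, F, j, hF, hj, Or.inl rfl⟩

/-- Distances scale with the mesh. [folklore] -/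
theorem dist_triMeshPoint_eq_mul (hδ : 0 < δ) (v : Site 2) (z : ℂ) :
    dist (triMeshPoint δ v) z = δ * dist (triEmbed v) ((δ⁻¹ : ℂ) * z) := by
  have hδ' : (δ : ℂ) ≠ 0 := Complex.ofReal_ne_zero.2 hδ.ne'
  rw [dist_eq_norm, dist_eq_norm, triMeshPoint]
  have : (δ : ℂ) * triEmbed v - z = (δ : ℂ) * (triEmbed v - (δ⁻¹ : ℂ) * z) := by field_simp
  rw [this, norm_mul, Complex.norm_real, Real.norm_eq_abs, abs_of_pos hδ]

/-- **The vertices of a cell containing `δ⁻¹ z` are within `4δ` of `z`.** [folklore] -/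
theorem dist_triMeshPoint_faceVertex_le (hδ : 0 < δ) {z : ℂ} {F : HexVertex} (hz : (δ⁻¹ : ℂ) * z ∈ triCell F)
    (k : Fin 3) : dist (triMeshPoint δ (faceVertex F k)) z ≤ 4 * δ := by
  rw [dist_triMeshPoint_eq_mul hδ]
  have h1 := norm_triEmbed_faceVertex_sub_le F k
  have h2 := norm_sub_triEmbed_le_of_mem_triCell hz
  have : dist (triEmbed (faceVertex F k)) ((δ⁻¹ : ℂ) * z) ≤ 4 := by
    rw [dist_eq_norm]
    have := norm_sub_le (triEmbed (faceVertex F k) - triEmbed F.1) ((δ⁻¹ : ℂ) * z - triEmbed F.1)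
    rw [sub_sub_sub_cancel_right] at this
    linarith [norm_sub_rev ((δ⁻¹ : ℂ) * z) (triEmbed F.1)]
  nlinarith

/-- Two indices of `Fin 3` leave a third one. [folklore] -/
theorem Fin3.exists_ne_ne (j j' : Fin 3) : ∃ k : Fin 3, k ≠ j ∧ k ≠ j' := by
  revert j j'; decide

/-- An index different from `j` is `j + 1` or `j + 2`. [folklore] -/
theorem Fin3.eq_or_eq_of_ne {j k : Fin 3} (h : k ≠ j) : k = j + 1 ∨ k = j + 2 := by
  revert j k; decide

end Cells

/-! ### Internal connectivity of the cut vertices seen from one exterior point -/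

section Reach

variable {Ω : Set ℂ} {δ : ℝ} {W : Set ℂ}

/-- The two endpoints of a cut side, inside the window, are joined (by that edge). [folklore] -/
theorem reachable_of_sameSide (hδ : 0 < δ) {z : ℂ} (hzW : closedBall z (4 * δ) ⊆ W) {F : HexVertex}
    (hz : (δ⁻¹ : ℂ) * z ∈ triCell F) {j : Fin 3} (hcut : IsCutEdge Ω δ (faceVertex F (j + 1)) (faceVertex F (j + 2)))
    {v v' : Site 2} (hv : v = faceVertex F (j + 1) ∨ v = faceVertex F (j + 2))
    (hv' : v' = faceVertex F (j + 1) ∨ v' = faceVertex F (j + 2)) : (offDomGraph Ω δ W).Reachable v v' := by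
  have hW : ∀ k, triMeshPoint δ (faceVertex F k) ∈ W := fun k ↦
    hzW (mem_closedBall.2 (dist_triMeshPoint_faceVertex_le hδ hz k))
  have hadj : (offDomGraph Ω δ W).Adj (faceVertex F (j + 1)) (faceVertex F (j + 2)) :=
    hcut.offDom_adj (hW _) (hW _)
  rcases hv with rfl | rfl <;> rcases hv' with rfl | rfl
  · rfl
  · exact hadj.reachable
  · exact hadj.symm.reachable
  · rfl

/-- **Endpoints of two cut sides of one cell are joined** (the sides share a vertex).
[folklore] -/
theorem reachable_of_sameCell (hδ : 0 < δ) {z : ℂ} (hzW : closedBall z (4 * δ) ⊆ W) {F : HexVertex}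
    (hz : (δ⁻¹ : ℂ) * z ∈ triCell F) {j j' : Fin 3}
    (hcut : IsCutEdge Ω δ (faceVertex F (j + 1)) (faceVertex F (j + 2)))
    (hcut' : IsCutEdge Ω δ (faceVertex F (j' + 1)) (faceVertex F (j' + 2)))
    {v v' : Site 2} (hv : v = faceVertex F (j + 1) ∨ v = faceVertex F (j + 2))
    (hv' : v' = faceVertex F (j' + 1) ∨ v' = faceVertex F (j' + 2)) : (offDomGraph Ω δ W).Reachable v v' := by
  obtain ⟨k, hkj, hkj'⟩ := Fin3.exists_ne_ne j j'
  have hk : faceVertex F k = faceVertex F (j + 1) ∨ faceVertex F k = faceVertex F (j + 2) := by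
    rcases Fin3.eq_or_eq_of_ne hkj with rfl | rfl
    exacts [Or.inl rfl, Or.inr rfl]
  have hk' : faceVertex F k = faceVertex F (j' + 1) ∨ faceVertex F k = faceVertex F (j' + 2) := by
    rcases Fin3.eq_or_eq_of_ne hkj' with rfl | rfl
    exacts [Or.inl rfl, Or.inr rfl]
  exact (reachable_of_sameSide hδ hzW hz hcut hv hk).trans (reachable_of_sameSide hδ hzW hz hcut' hk' hv')

/-- A side containing (after rescaling) an exterior point is cut. [folklore] -/
theorem isCutEdge_of_mem_triSide (hδ : 0 < δ) {z : ℂ} (hzE : z ∈ (closure Ω)ᶜ) {F : HexVertex} {j : Fin 3}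
    (hz : (δ⁻¹ : ℂ) * z ∈ triSide F j) : IsCutEdge Ω δ (faceVertex F (j + 1)) (faceVertex F (j + 2)) :=
  isCutEdge_of_mem (triGraph_adj_faceVertex_succ F j) ((mem_side_mesh_iff hδ.ne').2 hz) hzE

/-- **Endpoints of the sides of two distinct cells through a common point are joined**: the two
unit edges through the point share an endpoint there, or coincide (`unitEdge_inter`).
[folklore] -/
theorem reachable_of_adjCells (hδ : 0 < δ) {z : ℂ} (hzE : z ∈ (closure Ω)ᶜ) (hzW : closedBall z (4 * δ) ⊆ W)
    {F F' : HexVertex} (hz : (δ⁻¹ : ℂ) * z ∈ triCell F) (hz' : (δ⁻¹ : ℂ) * z ∈ triCell F') {i i' : Fin 3}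
    (hi : (δ⁻¹ : ℂ) * z ∈ triSide F i) (hi' : (δ⁻¹ : ℂ) * z ∈ triSide F' i')
    {v v' : Site 2} (hv : v = faceVertex F (i + 1) ∨ v = faceVertex F (i + 2))
    (hv' : v' = faceVertex F' (i' + 1) ∨ v' = faceVertex F' (i' + 2)) : (offDomGraph Ω δ W).Reachable v v' := by
  have hcut := isCutEdge_of_mem_triSide hδ hzE hi
  have hcut' := isCutEdge_of_mem_triSide hδ hzE hi'
  -- the two unit edges through `δ⁻¹ z`
  have hi1 : (δ⁻¹ : ℂ) * z ∈ segment ℝ (triEmbed (faceVertex F (i + 1)))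
      (triEmbed (faceVertex F (i + 1) + triDir (faceDartDir F (i + 1)))) := by
    rw [← faceVertex_add_two_eq]; exact hi
  have hi2 : (δ⁻¹ : ℂ) * z ∈ segment ℝ (triEmbed (faceVertex F' (i' + 1)))
      (triEmbed (faceVertex F' (i' + 1) + triDir (faceDartDir F' (i' + 1)))) := by
    rw [← faceVertex_add_two_eq]; exact hi'
  rcases unitEdge_inter hi1 hi2 with ⟨h1, h2⟩ | ⟨h1, h2⟩ | ⟨h1, h2⟩
  · -- a common endpoint `s`
    rw [← faceVertex_add_two_eq] at h1 h2
    obtain ⟨s, hs, hs'⟩ : ∃ s : Site 2, (s = faceVertex F (i + 1) ∨ s = faceVertex F (i + 2)) ∧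
        (s = faceVertex F' (i' + 1) ∨ s = faceVertex F' (i' + 2)) := by
      rcases h1 with h1 | h1 <;> rcases h2 with h2 | h2
      · exact ⟨_, Or.inl rfl, Or.inl (triEmbed_injective (h1.symm.trans h2))⟩
      · exact ⟨_, Or.inl rfl, Or.inr (triEmbed_injective (h1.symm.trans h2))⟩
      · exact ⟨_, Or.inr rfl, Or.inl (triEmbed_injective (h1.symm.trans h2))⟩
      · exact ⟨_, Or.inr rfl, Or.inr (triEmbed_injective (h1.symm.trans h2))⟩
    exact (reachable_of_sameSide hδ hzW hz hcut hv hs).trans (reachable_of_sameSide hδ hzW hz' hcut' hs' hv')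
  · -- the same edge, same orientation
    rw [← faceVertex_add_two_eq, ← faceVertex_add_two_eq] at h2
    have hv'' : v' = faceVertex F (i + 1) ∨ v' = faceVertex F (i + 2) := by
      rcases hv' with rfl | rfl
      exacts [Or.inl h1.symm, Or.inr h2.symm]
    exact reachable_of_sameSide hδ hzW hz hcut hv hv''
  · -- the same edge, opposite orientation
    rw [← faceVertex_add_two_eq] at h1
    rw [← faceVertex_add_two_eq] at h2
    have hv'' : v' = faceVertex F (i + 1) ∨ v' = faceVertex F (i + 2) := by
      rcases hv' with rfl | rfl
      exacts [Or.inr h2.symm, Or.inl h1.symm]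
    exact reachable_of_sameSide hδ hzW hz hcut hv hv''

/-- **The cut vertices seen from an exterior point are mutually joined** in `offDomGraph`
(within `4δ` of the point). [folklore] -/
theorem reachable_of_mem_cutVerts (hδ : 0 < δ) {z : ℂ} (hzE : z ∈ (closure Ω)ᶜ) (hzW : closedBall z (4 * δ) ⊆ W)
    {v₁ v₂ : Site 2} (h₁ : v₁ ∈ cutVerts Ω δ z) (h₂ : v₂ ∈ cutVerts Ω δ z) : (offDomGraph Ω δ W).Reachable v₁ v₂ := by
  obtain ⟨F₁, j₁, hz₁, hc₁, hv₁⟩ := h₁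
  obtain ⟨F₂, j₂, hz₂, hc₂, hv₂⟩ := h₂
  by_cases hF : F₁ = F₂
  · subst hF
    exact reachable_of_sameCell hδ hzW hz₁ hc₁ hc₂ hv₁ hv₂
  · obtain ⟨i, hi⟩ := exists_mem_triSide_of_mem_triCell_of_ne hz₁ hz₂ hF
    obtain ⟨i', hi'⟩ := exists_mem_triSide_of_mem_triCell_of_ne hz₂ hz₁ (Ne.symm hF)
    exact ((reachable_of_sameCell hδ hzW hz₁ hc₁ (isCutEdge_of_mem_triSide hδ hzE hi) hv₁ (Or.inl rfl)).trans
      (reachable_of_adjCells hδ hzE hzW hz₁ hz₂ hi hi' (Or.inl rfl) (Or.inl rfl))).trans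
      (reachable_of_sameCell hδ hzW hz₂ (isCutEdge_of_mem_triSide hδ hzE hi') hc₂ (Or.inl rfl) hv₂)

/-- **Upper semicontinuity of the cut vertices**: the cut vertices seen from a point close
enough to `z` are seen from `z`. [folklore] -/
theorem exists_cutVerts_subset (hδ : 0 < δ) (z : ℂ) :
    ∃ ε > 0, ∀ z', dist z' z < ε → cutVerts Ω δ z' ⊆ cutVerts Ω δ z := by
  obtain ⟨ε, hε, h⟩ := exists_ball_forall_triCell ((δ⁻¹ : ℂ) * z)
  refine ⟨δ * ε, by positivity, fun z' hz' v hv ↦ ?_⟩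
  obtain ⟨F, j, hF, hcut, hv⟩ := hv
  refine ⟨F, j, h _ ?_ F hF, hcut, hv⟩
  rw [dist_eq_norm, ← mul_sub, norm_mul, norm_inv, Complex.norm_real, Real.norm_eq_abs, abs_of_pos hδ]
  rw [dist_eq_norm] at hz'
  rw [inv_mul_lt_iff₀ hδ]
  exact hz'

/-- **Transport along an exterior path.** If a continuous path runs in the exterior
`(closure Ω)ᶜ` of a Jordan domain, with its `4δ`-neighbourhood in the window `W`, then every cut
vertex seen from its start is joined in `offDomGraph Ω δ W` to every cut vertex seen from its end
(the set of joined cut vertices is open and closed in time, by upper semicontinuity and the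
internal connectivity at each point, and nonempty by `cutVerts_nonempty`). [folklore] -/
theorem reachable_of_path (Dj : RandomPlanarGeometry.JordanDomain) (hδ : 0 < δ) {e e' : ℂ} (π : Path e e')
    (hE : ∀ t, π t ∈ (closure Dj.carrier)ᶜ) (hW : ∀ t, closedBall (π t) (4 * δ) ⊆ W)
    {v v' : Site 2} (hv : v ∈ cutVerts Dj.carrier δ e) (hv' : v' ∈ cutVerts Dj.carrier δ e') :
    (offDomGraph Dj.carrier δ W).Reachable v v' := by
  set S : Set unitInterval := {t | ∀ u ∈ cutVerts Dj.carrier δ (π t), (offDomGraph Dj.carrier δ W).Reachable v u}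
    with hS
  -- local inclusion of cut vertices along the path
  have hloc : ∀ t₀ : unitInterval, ∀ᶠ t in 𝓝 t₀, cutVerts Dj.carrier δ (π t) ⊆ cutVerts Dj.carrier δ (π t₀) := by
    intro t₀
    obtain ⟨ε, hε, h⟩ := exists_cutVerts_subset (Ω := Dj.carrier) hδ (π t₀)
    have : ∀ᶠ t in 𝓝 t₀, dist (π t) (π t₀) < ε :=
      π.continuous.continuousAt.eventually (Metric.ball_mem_nhds _ hε)
    exact this.mono fun t ht ↦ h _ ht
  have hopen : IsOpen S := by
    rw [isOpen_iff_mem_nhds]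
    intro t₀ ht₀
    exact (hloc t₀).mono fun t ht u hu ↦ ht₀ u (ht hu)
  have hclosed : IsClosed S := by
    rw [← isOpen_compl_iff, isOpen_iff_mem_nhds]
    intro t₀ ht₀
    simp only [hS, mem_compl_iff, mem_setOf_eq, not_forall] at ht₀
    obtain ⟨u₀, hu₀, hnot⟩ := ht₀
    refine (hloc t₀).mono fun t ht htS ↦ hnot ?_
    obtain ⟨u, hu⟩ := cutVerts_nonempty Dj hδ (hE t)
    exact (htS u hu).trans (reachable_of_mem_cutVerts hδ (hE t₀) (hW t₀) (ht hu) hu₀)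
  have h0 : (0 : unitInterval) ∈ S := fun u hu ↦ by
    rw [π.source] at hu
    exact reachable_of_mem_cutVerts hδ (by simpa using hE 0) (by simpa using hW 0) hv hu
  have huniv : S = univ := IsClopen.eq_univ ⟨hclosed, hopen⟩ ⟨0, h0⟩
  have h1 : (1 : unitInterval) ∈ S := by rw [huniv]; exact mem_univ _
  have := h1 v' (by rw [π.target]; exact hv')
  exact this

end Reach

/-! ### Frozen sites: exterior representatives of the sites of the discrete boundary -/

section Boundary

variable {δ : ℝ} {W : Set ℂ}

/-- **A lattice point in a closed cell is one of its vertices.** [folklore] -/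
theorem exists_eq_faceVertex_of_triEmbed_mem_triCell {F : HexVertex} {v : Site 2} (hv : triEmbed v ∈ triCell F) :
    ∃ k, v = faceVertex F k := by
  obtain ⟨a0, a1, b0, b1⟩ := coords_of_mem_triCell hv
  rw [triX_triEmbed] at a0 a1
  rw [triY_triEmbed] at b0 b1
  have h2 := hv 0; have h3 := hv 1; have h4 := hv 2
  have c0 : F.1 0 ≤ v 0 := by exact_mod_cast a0
  have c1 : v 0 ≤ F.1 0 + 1 := by exact_mod_cast a1
  have d0 : F.1 1 ≤ v 1 := by exact_mod_cast b0
  have d1 : v 1 ≤ F.1 1 + 1 := by exact_mod_cast b1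
  rcases F with ⟨x, t⟩
  rcases HexVertex.snd_eq_zero_or_one (x, t) with ht | ht <;> simp only at ht <;> subst ht <;>
    simp only [cellForm, Fin.isValue, ↓reduceIte, one_ne_zero, Matrix.cons_val_zero, Matrix.cons_val_one,
      Matrix.cons_val_two, Matrix.head_cons, Matrix.tail_cons, triX_triEmbed, triY_triEmbed] at h2 h3 h4 c0 c1 d0 d1
  · -- up face: `v₀ + v₁ ≤ x₀ + x₁ + 1`
    have e : v 0 + v 1 ≤ x 0 + x 1 + 1 := by
      have : (v 0 : ℝ) + v 1 ≤ x 0 + x 1 + 1 := by linarith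
      exact_mod_cast this
    have : (v 0 = x 0 ∧ v 1 = x 1) ∨ (v 0 = x 0 + 1 ∧ v 1 = x 1) ∨ (v 0 = x 0 ∧ v 1 = x 1 + 1) := by omega
    rcases this with ⟨h0, h1⟩ | ⟨h0, h1⟩ | ⟨h0, h1⟩
    · exact ⟨0, by ext i; fin_cases i <;> simp [faceVertex, h0, h1]⟩
    · exact ⟨1, by ext i; fin_cases i <;> simp [faceVertex, h0, h1]⟩
    · exact ⟨2, by ext i; fin_cases i <;> simp [faceVertex, h0, h1]⟩
  · -- down face: `x₀ + x₁ + 1 ≤ v₀ + v₁`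
    have e : x 0 + x 1 + 1 ≤ v 0 + v 1 := by
      have : (x 0 : ℝ) + x 1 + 1 ≤ v 0 + v 1 := by linarith
      exact_mod_cast this
    have : (v 0 = x 0 + 1 ∧ v 1 = x 1) ∨ (v 0 = x 0 + 1 ∧ v 1 = x 1 + 1) ∨ (v 0 = x 0 ∧ v 1 = x 1 + 1) := by omega
    rcases this with ⟨h0, h1⟩ | ⟨h0, h1⟩ | ⟨h0, h1⟩
    · exact ⟨0, by ext i; fin_cases i <;> simp [faceVertex, h0, h1]⟩
    · exact ⟨1, by ext i; fin_cases i <;> simp [faceVertex, h0, h1, add_assoc]⟩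
    · exact ⟨2, by ext i; fin_cases i <;> simp [faceVertex, h0, h1]⟩

/-- The discrete domain is closed under mesh-graph neighbours that are mesh vertices (private
copy of `TriBoxCrossingProofs.mem_triMeshDomain_of_triMeshGraph_adj`). [folklore] -/
private theorem mem_triMeshDomain_of_triMeshGraph_adj' {Ω : Set ℂ} {x y : Site 2}
    (hx : x ∈ triMeshDomain Ω δ) (hy : y ∈ triMeshVertices Ω δ)
    (hxy : (triMeshGraph Ω δ).Adj x y) : y ∈ triMeshDomain Ω δ := by
  simp only [triMeshDomain, mem_iUnion, mem_image] at hx ⊢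
  obtain ⟨C, hC, x', hx'C, rfl⟩ := hx
  refine ⟨C, hC, ⟨y, hy⟩, ?_, rfl⟩
  rw [SimpleGraph.ConnectedComponent.mem_supp_iff] at hx'C ⊢
  rw [← hx'C]
  exact SimpleGraph.ConnectedComponent.sound
    (SimpleGraph.Adj.reachable (show (triMeshVertexGraph Ω δ).Adj ⟨y, hy⟩ x' from hxy.symm))

/-- **Every site of the discrete boundary has an exterior representative**: a point `e` of the
exterior `(closure Ω)ᶜ` within `2δ` of its mesh point and a cut vertex `v` seen from `e`, joined
to the site by at most two edges of `offDomGraph` (along the non-`Ω_δ` edge witnessing the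
boundary site, then possibly one edge at a lattice point off `Ω_δ`). The window must contain the
`7δ`-ball about the site. (Smirnov 2001, §2: boundary sites are within one mesh of `∂Ω`.)
[cite: Smirnov2001, §2] -/
theorem exists_exterior_repr (Dj : RandomPlanarGeometry.JordanDomain) (hδ : 0 < δ) {p : Site 2}
    (hp : p ∈ triMeshBoundary Dj.carrier δ) (hpW : closedBall (triMeshPoint δ p) (7 * δ) ⊆ W) :
    ∃ (e : ℂ) (v : Site 2), e ∈ (closure Dj.carrier)ᶜ ∧ v ∈ cutVerts Dj.carrier δ e ∧
      dist e (triMeshPoint δ p) ≤ 2 * δ ∧ (offDomGraph Dj.carrier δ W).Reachable p v := by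
  obtain ⟨hpdom, y, hpy, hndom⟩ := hp
  have hdist : dist (triMeshPoint δ p) (triMeshPoint δ y) = δ := by
    have h1 := (triGraph_adj_iff_dist_holds _ _).1 hpy
    rw [triMeshPoint, triMeshPoint, dist_eq_norm, ← mul_sub, norm_mul, Complex.norm_real, Real.norm_eq_abs,
      abs_of_pos hδ, h1, mul_one]
  have hpW' : triMeshPoint δ p ∈ W := hpW (mem_closedBall_self (by positivity))
  have hyW : triMeshPoint δ y ∈ W := hpW (mem_closedBall.2 (by rw [dist_comm, hdist]; linarith))
  by_cases hseg : segment ℝ (triMeshPoint δ p) (triMeshPoint δ y) ⊆ closure Dj.carrier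
  · -- the edge is in `closure Ω`: then `y` is a lattice point off `Ω_δ`, on the boundary curve
    have hmesh : (triMeshGraph Dj.carrier δ).Adj p y := triMeshGraph_adj_iff.2 ⟨hpy, hseg⟩
    have hydom : y ∉ triMeshDomain Dj.carrier δ := fun h ↦
      hndom (triDiscreteDomainGraph_adj_iff.2 ⟨hmesh, hpdom, h⟩)
    have hyvert : y ∉ triMeshVertices Dj.carrier δ := fun h ↦
      hydom (mem_triMeshDomain_of_triMeshGraph_adj' hpdom h hmesh)
    have hyfr : triMeshPoint δ y ∈ frontier Dj.carrier := by
      rw [frontier, Dj.isOpen.interior_eq]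
      exact ⟨hseg (right_mem_segment _ _ _), hyvert⟩
    -- an exterior point very close to `δ y`
    obtain ⟨ε₁, hε₁, hcell⟩ := exists_ball_forall_triCell (triEmbed y)
    have hycl : triMeshPoint δ y ∈ closure (closure Dj.carrier)ᶜ := Dj.frontier_subset_closure_exterior' hyfr
    obtain ⟨e, heE, he⟩ := Metric.mem_closure_iff.1 hycl (min (δ * ε₁) δ) (lt_min (by positivity) hδ)
    have heδ : dist e (triMeshPoint δ y) < δ := by rw [dist_comm]; exact he.trans_le (min_le_right _ _)
    -- the cell of `e` has `y` as a vertex and a cut side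
    obtain ⟨F, hF⟩ := exists_mem_triCell ((δ⁻¹ : ℂ) * e)
    have hyF : triEmbed y ∈ triCell F := by
      refine hcell _ ?_ F hF
      have h1 : dist ((δ⁻¹ : ℂ) * e) (triEmbed y) = δ⁻¹ * dist e (triMeshPoint δ y) := by
        rw [dist_comm e, dist_triMeshPoint_eq_mul hδ, dist_comm]
        field_simp
      rw [h1, inv_mul_lt_iff₀ hδ, dist_comm]
      exact he.trans_le (min_le_left _ _)
    obtain ⟨k, hk⟩ := exists_eq_faceVertex_of_triEmbed_mem_triCell hyF
    obtain ⟨j, hj⟩ := exists_isCutEdge_of_mem_triCell Dj hδ heE hF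
    refine ⟨e, faceVertex F (j + 1), heE, ⟨F, j, hF, hj, Or.inl rfl⟩, ?_, ?_⟩
    · linarith [dist_triangle e (triMeshPoint δ y) (triMeshPoint δ p), dist_comm (triMeshPoint δ p) (triMeshPoint δ y)]
    · -- `p → y → faceVertex F (j+1)`
      have hvW : ∀ k', triMeshPoint δ (faceVertex F k') ∈ W := fun k' ↦ by
        refine hpW (mem_closedBall.2 ?_)
        have := dist_triMeshPoint_faceVertex_le hδ hF k'
        linarith [dist_triangle (triMeshPoint δ (faceVertex F k')) e (triMeshPoint δ p),
          dist_triangle e (triMeshPoint δ y) (triMeshPoint δ p), dist_comm (triMeshPoint δ p) (triMeshPoint δ y)]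
      have h1 : (offDomGraph Dj.carrier δ W).Adj p y := ⟨hpy, hndom, hpW', hyW⟩
      refine h1.reachable.trans ?_
      by_cases hyv : y = faceVertex F (j + 1)
      · rw [hyv]
      · have hadj : triGraph.Adj y (faceVertex F (j + 1)) := by
          rw [hk] at hyv ⊢
          exact adj_of_mem_hexFaceVertices (faceVertex_mem _ _) (faceVertex_mem _ _) hyv
        refine SimpleGraph.Adj.reachable ⟨hadj, fun h ↦ hydom (triDiscreteDomainGraph_adj_iff.1 h).2.1, hyW, hvW _⟩
  · -- the edge leaves `closure Ω`: an exterior point on it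
    obtain ⟨e, he, heΩ⟩ := not_subset.1 hseg
    set F := leftFace p y with hF
    obtain ⟨j, hpj, hyj⟩ := exists_eq_faceVertex_of_adj hpy
    rw [← hF] at hpj hyj
    have hside : (δ⁻¹ : ℂ) * e ∈ triSide F (j + 2) := by
      rw [triSide, TriMarkedDomain.fin3_add_two_add_one, TriMarkedDomain.fin3_add_two_add_two, ← hpj, ← hyj]
      rw [triMeshPoint, triMeshPoint, mem_segment_ofReal_mul_iff hδ.ne'] at he
      exact he
    have hcut : IsCutEdge Dj.carrier δ (faceVertex F (j + 2 + 1)) (faceVertex F (j + 2 + 2)) := by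
      rw [TriMarkedDomain.fin3_add_two_add_one, TriMarkedDomain.fin3_add_two_add_two, ← hpj, ← hyj]
      exact ⟨hpy, hseg⟩
    refine ⟨e, p, heΩ, ⟨F, j + 2, triSide_subset_triCell F _ hside, hcut, Or.inl ?_⟩, ?_, SimpleGraph.Reachable.refl _⟩
    · rw [TriMarkedDomain.fin3_add_two_add_one]; exact hpj
    · have : e ∈ closedBall (triMeshPoint δ p) δ :=
        (convex_closedBall _ _).segment_subset (mem_closedBall_self hδ.le)
          (mem_closedBall.2 (by rw [dist_comm, hdist])) he
      linarith [mem_closedBall.1 this]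

end Boundary

/-! ### Off-domain walks keep mesh points in one component of the complement of the polygon -/

section Component

variable {Dd : DiscreteDobrushin} {ω : SiteConfig (Site 2)} {f₀ g₀ : HexVertex}
  {w : hexGraph.Walk f₀ g₀} (hw : IsExplorationPath Dd ω w)

include hw

/-- **A walk of non-`Ω_δ` edges keeps the mesh points of its sites in one component of
`A ∖ trace`**, provided the `δ`-neighbourhoods of the window lie in `A`: its edges are never
crossed by the exploration path, hence miss the polygon
(`segment_disjoint_polyTrace_of_not_domAdj`). [folklore] -/
theorem _root_.Literature.Probability.LatticeModels.IsExplorationPath.triMeshPoint_mem_connectedComponentIn_of_reachable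
    (hδ : 0 < Dd.δ) {A W : Set ℂ} (hWA : ∀ z ∈ W, closedBall z Dd.δ ⊆ A) {u v : Site 2}
    (h : (offDomGraph Dd.Ω Dd.δ W).Reachable u v) (hu : triMeshPoint Dd.δ u ∈ W) :
    triMeshPoint Dd.δ v ∈ connectedComponentIn (A \ polyTrace Dd.δ w) (triMeshPoint Dd.δ u) := by
  obtain ⟨P⟩ := h
  induction P with
  | nil =>
    exact mem_connectedComponentIn ⟨hWA _ hu (mem_closedBall_self hδ.le), hw.triMeshPoint_not_mem_polyTrace hδ _⟩
  | @cons a b c hab P ih =>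
    have hbW : triMeshPoint Dd.δ b ∈ W := hab.2.2.2
    have hb : triMeshPoint Dd.δ b ∈ connectedComponentIn (A \ polyTrace Dd.δ w) (triMeshPoint Dd.δ a) := by
      have hseg : segment ℝ (triMeshPoint Dd.δ a) (triMeshPoint Dd.δ b) ⊆ A \ polyTrace Dd.δ w := by
        intro z hz
        refine ⟨hWA _ hu ?_, disjoint_left.1 (hw.segment_disjoint_polyTrace_of_not_domAdj hδ hab.1 hab.2.1) hz⟩
        exact (convex_closedBall _ _).segment_subset (mem_closedBall_self hδ.le)
          (mem_closedBall.2 (by rw [dist_comm]; exact dist_triMeshPoint_le_of_eq_or_adj hδ.le (Or.inr hab.1))) hz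
      exact (convex_segment _ _).isPreconnected.subset_connectedComponentIn (left_mem_segment _ _ _) hseg
        (right_mem_segment _ _ _)
    have := ih hbW
    rw [connectedComponentIn_eq hb]
    exact this

end Component

/-! ### Frozen sites with exterior-joined representatives share their side component -/

section Joined

variable {Dm : RandomPlanarGeometry.DobrushinDomain} {δ : ℝ} {ω : SiteConfig (Site 2)} {f₀ g₀ : HexVertex}
  {w : hexGraph.Walk f₀ g₀} (hw : IsExplorationPath (dobrushinData Dm δ) ω w)

include hw

/-- **Two boundary sites whose exterior representatives are joined by an exterior path have
their mesh points in one component of `A ∖ trace`.** Hypotheses: the path runs in the exterior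
with its `4δ`-neighbourhood in the window `W`, the `7δ`-balls about the two sites lie in `W`,
and the `δ`-neighbourhood of `W` lies in `A`. (Combination of `exists_exterior_repr`,
`reachable_of_path`, `reachable_of_mem_cutVerts` and
`triMeshPoint_mem_connectedComponentIn_of_reachable`.) [folklore] -/
theorem _root_.Literature.Probability.LatticeModels.IsExplorationPath.mem_connectedComponentIn_of_exterior_path
    (hδ : 0 < δ) {A W : Set ℂ} (hWA : ∀ z ∈ W, closedBall z δ ⊆ A) {p p' : Site 2}
    {e e' : ℂ} {v v' : Site 2} (hv : v ∈ cutVerts Dm.carrier δ e)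
    (hpv : (offDomGraph Dm.carrier δ W).Reachable p v)
    (hv' : v' ∈ cutVerts Dm.carrier δ e') (hpv' : (offDomGraph Dm.carrier δ W).Reachable p' v')
    (π : Path e e') (hπE : ∀ t, π t ∈ (closure Dm.carrier)ᶜ) (hπW : ∀ t, closedBall (π t) (4 * δ) ⊆ W)
    (hpW : triMeshPoint δ p ∈ W) :
    triMeshPoint δ p' ∈ connectedComponentIn (A \ polyTrace δ w) (triMeshPoint δ p) := by
  have hvv' : (offDomGraph Dm.carrier δ W).Reachable v v' := reachable_of_path Dm.toJordanDomain hδ π hπE hπW hv hv'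
  have hpp' : (offDomGraph Dm.carrier δ W).Reachable p p' := (hpv.trans hvv').trans hpv'.symm
  exact hw.triMeshPoint_mem_connectedComponentIn_of_reachable hδ hWA hpp' hpW

end Joined

end Literature.Probability.Percolation
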